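import Summits.CriticalPhenomena.PercolationContinuityZ3.Theses.PercPortalLadder
import Literature.Probability.Percolation.ConnectivityProofs

/-!
# Birth skeleton (BC3) for the crux `PortalGridRung` (stmt-CriticalPhenomena-14516)

Route `route-CriticalPhenomena-PercPortalLadder` (sub-problem `PercolationContinuityZ3`), crux decl
`Summit.CriticalPhenomena.PercolationContinuityZ3.Theses.PercPortalLadder.PortalGridRung` (rank 5, the top
filed rung of the portal ladder): there is a spacing `k ≥ 2` such that the RIVETED GRAPH
`G_{Π_k} := ℤ³` minus the crossing edges `s(x, x − e₀)`, `x₀ = 0`, `x ∉ Π_k = {k ∣ x₁, k ∣ x₂}` — two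
critical half-spaces `H⁺ = {x₀ ≥ 0}`, `H⁻ = {x₀ ≤ −1}` glued only through the rivets above the square grid
`Π_k` — has `θ_{G_{Π_k}}(v, p_c(ℤ³)) = 0` at every vertex `v`.

THE LINE = the route header's own layer-2 plan for this node ("PortalGridRung ⇐ GridOpenness →
PortalGridRung … BGN's finite-size-criterion-plus-steering scheme for rivet cascades; the glue is free:
`θ_{G_{Π_k}}(p) ≤ θ_{ℤ³}(p) = 0` for `p < p_c`"), i.e. Barsky–Grimmett–Newman ONE RUNG UP, cut exactly as
the Literature library cuts BGN itself (`Literature/Probability/Percolation/HalfSpaceHighDim.lean`: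
`theta_halfSpace_criticalProbI_eq_zero_of_open_phase` — "This — and not a block lemma for a fixed block
event — is the interface through which Theorem (7.35) follows", BGN 1991 Thm 1.2 (i) ⇒ Thm 1.1 (i),
Grimmett 1999 p. 169). With `gridGraph k := (zdGraph 3).deleteEdges (gridWall k)` the crux is LITERALLY
`∃ k ≥ 2, ∀ v, θ_{gridGraph k}(v, p_c) = 0` (`portalGridRung_iff`, `Iff.rfl`). Two registered stubs:

* STUB 1 `stub_gridOpenPhase` (XL, OPEN — LOAD-BEARING): **the percolating phase of some riveted graph is
  open from the left** — `∃ k ≥ 2, ∀ p, (∃ v, θ_{G_{Π_k}}(v,p) > 0) → ∃ p' < p, ∃ w, θ_{G_{Π_k}}(w,p') > 0`.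
  This is BGN's Theorem 1.2 (i) ("if `θ_ℍ(p) > 0` there is `δ > 0` with `θ(p − δ) > 0`") for `G_{Π_k}` in
  place of `ℍ`, in the `hopen` shape of `theta_halfSpace_criticalProbI_eq_zero_of_open_phase`. Its natural
  proof is `p_c`-BLIND: a finite-size criterion for rivet-cascade percolation (steer inside `H^±` between
  rivets, renew at rivets — Grimmett 1999 §7.3 Lemmas (7.36)/(7.52), in tree for `ℍ` as the `good d m L H`
  machinery of `HalfSpaceHighDim` / `BGN.*`) plus continuity of `q ↦ P_q(block event)`. Instances: `p > p_c`
  TRUE in tree-reach (`H⁺ ⊆ G_{Π_k}` edge-wise and `θ_ℍ(p') > 0` for `p_c < p' < p`: `p_c(ℍ) = p_c`,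
  `criticalProb_halfSpace_eq` / `theta_halfSpace_pos_of_criticalProb_lt`); `p < p_c` VACUOUS (STUB 2);
  `p = p_c` is the content — so modulo STUB 2 and tree facts STUB 1 ⟺ the crux, exactly as BGN Thm 1.2 (i)
  ⟺ Thm 1.1 (i) modulo (7.1): an honest piece, not a cheap one (BC3 probes below). `k = 1` would be the
  open phase of `ℤ³` itself (≡ the conjunct: `gridWall 1 = ∅`) and is excluded by `2 ≤ k`, as in the crux.
* STUB 2 `stub_deleteEdgesMono` (M, PROVABLE NOW): **deleting edges can only lower `θ`** —
  `θ_{(zdGraph 3).deleteEdges E}(w, p) ≤ θ_{ℤ³}(w, p)` for every edge set `E`, vertex `w`, `p ∈ [0,1]`.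
  The restriction coupling `ω ↦ ω ∖ E`: `(setBer(E(ℤ³), p)).map (· ∩ Eᶜ) = setBer(E(ℤ³) ∖ E, p)`
  (`setBernoulli_map_inter`, `Literature.Barriers.CriticalPhenomena.TimarCriticalNonunimodular`;
  `SimpleGraph.edgeSet_deleteEdges`) and `percolatesAt w` is monotone in `ω` (`openCluster` grows with `ω`);
  measurability `measurableSet_percolatesAt_holds`. Pattern: `theta_comap_le` / `bondPercolation_map_comap`
  in `SubgraphMonotonicity.lean` (which covers INDUCED subgraphs only — no edge-deletion version is in the
  tree, `exact?` fails, info probe E). The SAME lemma is the missing input of the route's glue item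
  `PlaneOfPortalGrid` (stmt-CriticalPhenomena-14518, grounder g39-14: "needs the θ-monotonicity-under-edge-
  deletion lemma"), so one proof serves both.

Composition (kernel-checked, no `sorry`): `PortalGridRung_of : stub_gridOpenPhase → stub_deleteEdgesMono →
PortalGridRung` (hypotheses typed by the name-keyed aliases `__Registered.stub_*`) — Grimmett's p. 169
argument run on `G_{Π_k}`: if `θ_{G_{Π_k}}(v, p_c) ≠ 0` it is `> 0` (`measureReal_nonneg`), STUB 1 gives
`p' < p_c` and `w` with `θ_{G_{Π_k}}(w, p') > 0`, but `θ_{G_{Π_k}}(w, p') ≤ θ_{ℤ³}(w, p') = θ_{ℤ³}(0, p') = 0`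
(STUB 2, `theta_zdGraph_eq_theta_zero`, `theta_eq_zero_of_lt_criticalProb_holds`) — contradiction.

BC3 (planner probes, 2026-08-17, `bc/PortalGridRung_bc3_probes.lean`, stub statements re-declared WITHOUT the
sorried theorems in scope): `stub_gridOpenPhase → PortalGridRung`, `stub_gridOpenPhase → PercolationContinuityZ3`,
`stub_deleteEdgesMono → PortalGridRung`, `stub_deleteEdgesMono → PercolationContinuityZ3`, each by
`first | exact? | simpa [stub] | (unfold stub; simpa) | aesop` at 400k heartbeats: 4/4 FAIL (unsolved goals;
aesop exhaustive search failed). Info probes (`bc/PortalGridRung_bc3_info_probes.lean`): joint cheap probe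
`stub₁ → stub₂ → crux` FAILS (the composition is not a one-liner), `crux → stub₁`, `S → stub₁`, `S → stub₂`
FAIL, `exact?` on STUB 2 alone FAILS (timeout: no such lemma).

DISPROOF USED: none exists for this crux (`ledger crux ls stmt-CriticalPhenomena-14516`: no workfiles, no
`Disproof.lean`, no landed Negative lemma, 2026-08-17). Negatives index (11 refuted statements of the summit):
none concerns half-spaces, perforated planes, edge-deletion monotonicity or open phases. Kill criteria of the
route apply to STUB 1 as to the crux (refutable only together with `θ_{ℤ³}(p_c) > 0` AND grid-wall percolation
at `p_c` for every `k ≥ 2`); STUB 2 is a theorem of the coupling.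

NOT REGISTERED (foreseen layer below STUB 1, provers' `--supports` lemmas, D-0019 two-layer cap): the
(7.36)-analogue "rivet-cascade percolation at `p` ⇒ a finite-size (block) criterion at `p`", the continuity of
the block probability in `p` (cylinder event), and the (7.52)-analogue "block criterion at `p'` ⇒ `G_{Π_k}`
percolates at `p'`" (dynamic renormalisation WITHOUT sprinkling, steering between rivets) — the block event
for rivet cascades is the creative content of STUB 1 and is deliberately not frozen here.
-/

noncomputable section

namespace Summit.CriticalPhenomena.PercolationContinuityZ3.Cruxes.PortalGridRung.Birth

open MeasureTheory Literature.Probability.Percolation Literature.Probability.LatticeModels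
open Summit.CriticalPhenomena.PercolationContinuityZ3.Theses.PercPortalLadder (PortalGridRung)

/-! ## Objects of the line -/

/-- The SEALED WALL of spacing `k`: the crossing ("portal") edges `s(x, x − e₀)`, `x₀ = 0`, that are
NOT above the rivet grid `Π_k = {x₀ = 0, k ∣ x₁, k ∣ x₂}` (verbatim the edge set deleted in the crux). -/
def gridWall (k : ℕ) : Set (Sym2 (Site 3)) :=
  {e | ∃ x : Site 3, x 0 = 0 ∧ x ∉ {y : Site 3 | (k : ℤ) ∣ y 1 ∧ (k : ℤ) ∣ y 2} ∧
    e = s(x, x - Pi.single 0 1)}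

/-- The RIVETED GRAPH `G_{Π_k}`: `ℤ³` minus the sealed wall — the two half-spaces `H⁺ = {x₀ ≥ 0}`,
`H⁻ = {x₀ ≤ −1}` glued only through the rivets above `Π_k`. -/
def gridGraph (k : ℕ) : SimpleGraph (Site 3) := (zdGraph 3).deleteEdges (gridWall k)

/-- The crux is literally `∃ k ≥ 2, ∀ v, θ_{G_{Π_k}}(v, p_c(ℤ³)) = 0`. -/
theorem portalGridRung_iff :
    PortalGridRung ↔ ∃ k : ℕ, 2 ≤ k ∧ ∀ v : Site 3, theta (gridGraph k) v (criticalProbI 3) = 0 :=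
  Iff.rfl

/-! ## The two stub statements -/

/-- STUB 1 statement: the percolating phase of some riveted graph `G_{Π_k}`, `k ≥ 2`, is open from the
left (BGN 1991 Thm 1.2 (i) one rung up; `hopen` shape of
`Literature.Probability.Percolation.theta_halfSpace_criticalProbI_eq_zero_of_open_phase`). -/
def GridOpenPhase : Prop :=
  ∃ k : ℕ, 2 ≤ k ∧ ∀ p : unitInterval, (∃ v : Site 3, 0 < theta (gridGraph k) v p) →
    ∃ p' : unitInterval, (p' : ℝ) < (p : ℝ) ∧ ∃ w : Site 3, 0 < theta (gridGraph k) w p'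

/-- STUB 2 statement: deleting edges of `ℤ³` can only lower `θ` (restriction coupling `ω ↦ ω ∖ E`). -/
def DeleteEdgesMono : Prop :=
  ∀ (E : Set (Sym2 (Site 3))) (w : Site 3) (p : unitInterval),
    theta ((zdGraph 3).deleteEdges E) w p ≤ theta (zdGraph 3) w p

/-! ## Registered stubs -/

/-- **STUB 1 `gridOpenPhase`** (XL, OPEN — LOAD-BEARING): `∃ k ≥ 2` such that for every `p ∈ [0,1]`, if
some vertex of `G_{Π_k}` percolates at `p` then some vertex of `G_{Π_k}` percolates at some `p' < p`.
Engine (none complete): BGN's scheme for rivet cascades — (7.36)-type finite-size criterion from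
percolation, continuity in `p` of the block probability, (7.52)-type block construction ⇒ percolation at the
SAME `p'` (no sprinkling; steering inside `H^±` between rivets, renewal at rivets; the rivet spacing `k` is
the only new small parameter: BK cascade counting makes rivet cascades subcritical below the scale
`R(k) ≈ k·(k^{1.95}/(cA))^{20}`). Why it might fail: at `p = p_c` it is the crux (the infrared of the rivet
sheet is bulk-coupled, RG eigenvalue `(d−1) − 2x_h1 ≈ +0.05`, Cardy 1996 §7.2 with Deng–Blöte 2005
exponents); no finite-size criterion for a positive-density perforated plane at bulk criticality is in
print (Iliev–Janse van Rensburg–Madras 2014 p. 5; Newman–Wu 1997). Sources: BarskyGrimmettNewman1991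
Thm 1.2 (i); Grimmett1999 Thm (7.35), Lemmas (7.36), (7.52), p. 169. -/
theorem stub_gridOpenPhase : GridOpenPhase := by
  sorry

/-- **STUB 2 `deleteEdgesMono`** (M, PROVABLE NOW): `θ_{ℤ³ ∖ E}(w, p) ≤ θ_{ℤ³}(w, p)`.
Proof sketch: `bondPercolation ((zdGraph 3).deleteEdges E) p = setBer(E(ℤ³) ∖ E, p)`
(`SimpleGraph.edgeSet_deleteEdges`) `= (bondPercolation (zdGraph 3) p).map (· ∩ Eᶜ)`
(`setBernoulli_map_inter` with `u ∩ Eᶜ = u ∖ E`), then `map_measureReal_apply` (measurability of `· ∩ Eᶜ`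
as in `setBernoulli_map_inter`; `measurableSet_percolatesAt_holds w`) and `measureReal_mono` along
`ω ∩ Eᶜ ⊆ ω ⇒ openCluster (ω ∩ Eᶜ) w ⊆ openCluster ω w` (`SimpleGraph.fromEdgeSet_mono` +
`Reachable.mono`), so `(· ∩ Eᶜ) ⁻¹' percolatesAt w ⊆ percolatesAt w`. Sources: Grimmett1999 §1.4 p. 13
(sublattice coupling), pattern `theta_comap_le`. -/
theorem stub_deleteEdgesMono : DeleteEdgesMono := by
  sorry

/-! ### Name-keyed aliases of the stub statements
`__Registered.stub_X` is statement `X` under the registered stub's short name, so that the native skeleton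
audit (`#h21_check_skeleton`: hypotheses admissible iff registered obligations / declared stubs BY NAME)
accepts `PortalGridRung_of : __Registered.stub_… → … → PortalGridRung` (device of
`Cruxes/BGNOffTheFloor/Lines/birth.lean`; the `@[stub]` attribute is gate-reserved). -/
namespace __Registered

/-- Alias of `GridOpenPhase` keyed by the registered stub name. -/
abbrev stub_gridOpenPhase : Prop := GridOpenPhase
/-- Alias of `DeleteEdgesMono` keyed by the registered stub name. -/
abbrev stub_deleteEdgesMono : Prop := DeleteEdgesMono

end __Registered

/-! ## Proved plumbing -/

/-- `θ ≥ 0` on the riveted graph (a probability). -/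
theorem theta_gridGraph_nonneg (k : ℕ) (v : Site 3) (p : unitInterval) :
    0 ≤ theta (gridGraph k) v p :=
  measureReal_nonneg

/-- STUB 2 specialised to the sealed wall: `θ_{G_{Π_k}}(w, p) ≤ θ_{ℤ³}(w, p)`. -/
theorem theta_gridGraph_le (hmono : DeleteEdgesMono) (k : ℕ) (w : Site 3) (p : unitInterval) :
    theta (gridGraph k) w p ≤ theta (zdGraph 3) w p :=
  hmono (gridWall k) w p

/-- The FREE GLUE of the route header: below `p_c(ℤ³)` no riveted graph percolates — STUB 2, translation
invariance of `θ_{ℤ³}` (`theta_zdGraph_eq_theta_zero`) and the definition of `p_c`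
(`theta_eq_zero_of_lt_criticalProb_holds`; `(criticalProbI 3 : ℝ) = criticalProb (zdGraph 3) 0` by `rfl`). -/
theorem theta_gridGraph_eq_zero_of_lt (hmono : DeleteEdgesMono) (k : ℕ) (w : Site 3)
    (p : unitInterval) (hp : (p : ℝ) < (criticalProbI 3 : ℝ)) : theta (gridGraph k) w p = 0 := by
  have hZ : theta (zdGraph 3) w p = 0 := by
    rw [theta_zdGraph_eq_theta_zero p w]
    exact theta_eq_zero_of_lt_criticalProb_holds (zdGraph 3) (0 : Site 3) p hp
  exact le_antisymm ((theta_gridGraph_le hmono k w p).trans_eq hZ) (theta_gridGraph_nonneg k w p)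

/-! ## The composition, by name -/

/-- **`PortalGridRung_of`**: the two registered stubs imply the crux
`Summit.CriticalPhenomena.PercolationContinuityZ3.Theses.PercPortalLadder.PortalGridRung`
(kernel-checked; no `sorry` outside the stubs) — Grimmett's proof of Thm (7.35) from BGN Thm 1.2 (i)
(p. 169, "it follows by contradiction"), run on `G_{Π_k}` instead of `ℍ`. -/
theorem PortalGridRung_of (hopen : __Registered.stub_gridOpenPhase)
    (hmono : __Registered.stub_deleteEdgesMono) :
    Summit.CriticalPhenomena.PercolationContinuityZ3.Theses.PercPortalLadder.PortalGridRung := by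
  obtain ⟨k, hk, hop⟩ := hopen
  refine portalGridRung_iff.2 ⟨k, hk, fun v => ?_⟩
  by_contra hne
  -- `θ_{G_{Π_k}}(v, p_c) > 0`, so the open phase gives a percolating vertex strictly below `p_c` …
  have hpos : 0 < theta (gridGraph k) v (criticalProbI 3) :=
    lt_of_le_of_ne (theta_gridGraph_nonneg k v _) (Ne.symm hne)
  obtain ⟨p', hp', w, hw⟩ := hop (criticalProbI 3) ⟨v, hpos⟩
  -- … where no subgraph of `ℤ³` percolates
  exact hw.ne' (theta_gridGraph_eq_zero_of_lt hmono k w p' hp')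

/-- Wiring check: the registered stubs feed `PortalGridRung_of` as stated. -/
example : Summit.CriticalPhenomena.PercolationContinuityZ3.Theses.PercPortalLadder.PortalGridRung :=
  PortalGridRung_of stub_gridOpenPhase stub_deleteEdgesMono

end Summit.CriticalPhenomena.PercolationContinuityZ3.Cruxes.PortalGridRung.Birth

end
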